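import Literature.MathematicalPhysics.QuantumFieldTheory.Dimock2011to13.LocalSquareRootDeterminant
import Literature.MathematicalPhysics.QuantumFieldTheory.BalabanImbrieJaffe1984to88.BIJ88Sect5StatementsPart4
import Literature.MathematicalPhysics.QuantumFieldTheory.BalabanImbrieJaffe1984to88.BIJ88Normalization46

/-!
# `BalabanImbrieJaffe1984to88.BIJ88TraceLog574` — T. Bałaban, J. Imbrie, A. Jaffe, *Effective action and cluster
properties of the abelian Higgs model*, Commun. Math. Phys. **114** (1988) 257–315 [BalabanImbrieJaffe1988], §5.7
*The Gaussian Normalization Factors*, p. 289: the trace–log expansion **(5.7.4)** of the determinant in **(5.7.3)**,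
PROVED for finite real matrices, and knitted to the typed normalization factor (4.9)

statement-level skeleton of published theorems with citation tags; proofs where landed; nothing here is a claim about the Yang–Mills mass gap

PDF held: `paper:balaban1988-cmp114-bij-abelian-higgs-effective-action` (journal page = PDF page + 256).  Render read this
session: p. 289 = PDF 33 (`pages/original-p033-x2.png` of the p02 seat).

**What the paper prints (p. 289, verbatim).**  After (5.7.2) *"C^{(j)}_{Λ₁₀^{(j)}}(u_{k+1}ũ̃)^{−1} = … =
C^{(j)}_{Λ₁₀^{(j)}}(u_{k+1})^{−1} − W^{(j)}"* and the factorization *"C^{(j)}(u_{k+1}ũ̃)^{−1} = C^{(j)}(u_{k+1})^{−1/2}(I −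
C^{(j)}(u_{k+1})^{1/2}W^{(j)}C^{(j)}(u_{k+1})^{1/2})C^{(j)}(u_{k+1})^{−1/2}, and so Z^{(j)}_{Λ₁₀^{(j)}}(u_k) =
Z^{(j)}_{Λ₁₀^{(j)}}(u_{k+1})[det(I − C^{(j)}_{Λ₁₀^{(j)}}(u_{k+1})^{1/2}W^{(j)}C^{(j)}_{Λ₁₀^{(j)}}(u_{k+1})^{1/2})]^{−1/2}. (5.7.3)"*:
*"Each term in W^{(j)} has at least one factor e_j, and all fields are logarithmically bounded. Thus the operator after the
identity is bounded by a very small number. Thus the determinant can be expanded as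
exp[Σ_{l=1}^{∞} (1/2l) tr(C^{(j)}_{Λ₁₀^{(j)}}(u_{k+1})W^{(j)})^l]. (5.7.4)"*.

**What is reproduced here (kernel-checked, zero `sorry`, no new definitions, no named facts).**  Finite real matrices on an
abstract finite index type `n` (print: the real coordinates of the scalar field on `Λ₁₀^{(j)}`, as in the tree's typing of
(4.9), `BIJ88Normalization46.Z49`); `S` stands for `C^{(j)}(u_{k+1})^{1/2}`, `Sinv` for `C^{−1/2}`, `Cinv = Sinv·Sinv` for
`C^{(j)}(u_{k+1})^{−1}`, `C = S·S`, `W` for `W^{(j)}`, `X = S W S` for *"the operator after the identity"*.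
* `trace_pow_sandwich` (helper `trace_pow_succ_mul_comm`) — cyclicity under the trace: `tr((C^{1/2}WC^{1/2})^l) = tr((CW)^l)`,
  `l ≥ 1` (the step from the determinant of (5.7.3) to the traces printed in (5.7.4)).
* `det_one_sub_eq_exp`, `det_one_sub_pos` — `det(I − X) = e^{tr log(I − X)} > 0` for `‖X‖ < 1`, `tr log(I − X) =
  −Σ_{l≥1}(1/l) tr X^l` being the tree's real number `Dimock2011to13.LocalSquareRootDeterminant.R5real X` (that file proves
  the Banach-algebra logarithm, Liouville's formula `det e^M = e^{tr M}` and the reality of the trace series; nothing of it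
  is restated).
* **`hasSum_eq574`** — the printed series CONVERGES: `Σ_{l≥1} (1/2l) tr((CW)^l) = −½ tr log(I − C^{1/2}WC^{1/2})` for
  `‖C^{1/2}WC^{1/2}‖ < 1`.
* **`det_rpow_eq574`** — **(5.7.4)**: `[det(I − C^{1/2}WC^{1/2})]^{−1/2} = exp[Σ_{l=1}^{∞} (1/2l) tr((CW)^l)]`, and its
  logarithmic form `log_det_eq574` (`−½ log det(I − C^{1/2}WC^{1/2}) = Σ_{l≥1}(1/2l) tr((CW)^l)`).
* `abs_tsum574_le`, `abs_tsum574_le_card_mul` (helpers `norm_cplx_eq`, `abs_R5real_le`, `neg_log_one_sub_le_two_mul`) — the size of the exponent from the smallness of the operator: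
  `|Σ_{l≥1}(1/2l) tr((CW)^l)| ≤ (#n/2)(−log(1 − ‖X‖)) ≤ #n·‖X‖` (the second for `‖X‖ ≤ ½`) — the quantitative content of
  *"bounded by a very small number"* ⟹ the exponent is small (linear in the volume).
* **`Z49_eq573`** — **(5.7.3)** at the level of the typed normalization factor (4.9) `Z49 T E N = e^{−EN}∫dφ e^{−½⟨φ,Tφ⟩}`:
  with `T(u_k) = C^{−1} − W` ((5.7.2), r16's `BIJ88Sect5StatementsPart4.eq572`/`det_eq573`) and `T(u_{k+1}) = C^{−1}` both
  positive definite, `Z(u_k) = Z(u_{k+1})·[det(I − C^{1/2}WC^{1/2})]^{−1/2}`; **`Z49_eq574`** — (5.7.3) with the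
  determinant expanded by (5.7.4); `prod_Z49_eq574` — the product over `j` (the left factorization in the summary (5.7.13),
  p. 295, whose resummed exponent `−Q^{(k)} − Σ_X W₂^{(k)}(X)` is NOT claimed).

**Readings (declared).**  (i) *"bounded by a very small number"* is read as `‖C^{1/2}WC^{1/2}‖ < 1` in the `ℓ^∞`-OPERATOR
norm of matrices (Mathlib scope `Matrix.Norms.Operator`, `‖A‖ = max_i Σ_j |A_{ij}|` = the sup-norm operator bound in which
kernel estimates of the §2/§5.4 type are stated); any submultiplicative matrix norm would serve, this is the one the
imported determinant calculus is written in.  (ii) `C^{1/2}` is ANY real matrix `S` with a two-sided inverse `Sinv` and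
`Sinv² = C^{−1}`, `S² = C` (symmetry/positivity of the square root is not used by (5.7.3)–(5.7.4); positivity enters only
through the hypotheses `Cinv.PosDef`, `(Cinv − W).PosDef` making the two Gaussian integrals (4.9) finite).  (iii) the sum
in (5.7.4) is indexed here by `l : ℕ` from `0` with the printed `l` being `l + 1`.

**What is NOT claimed.**  The smallness of `W^{(j)}` itself (*"Each term in W^{(j)} has at least one factor e_j …"* — the
inductive field bounds), the random-walk treatment of `C^{(j)}(u_{k+1})` announced after (5.7.4) ((2.45), (5.7.5) ff. —
r16's Part4 `eq575` and p36's files), the definition (5.7.1) of `ũ̃`/`u_{k+1}` (Part3 `eq566`), anything of (5.7.6)–(5.7.15);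
no quantity of the Bałaban series B1–B16 is touched.  NOT summit progress; NOT continuum; NOT Clay.  Imports: the tree's
`Dimock2011to13.LocalSquareRootDeterminant` (generic finite-dimensional `tr log` calculus, used by name), r16's
`BIJ88Sect5StatementsPart4` ((5.7.2)/(5.7.3) algebra) and r18's `BIJ88Normalization46` ((4.9)); no Summits import; modifies
nothing.  Cell `lit-balaban` Phase 2, seat p02 gen 4; row C2.Eq5.7.1-5.7.4 (owner r16), member (5.7.4) «absent» → proved.
-/

noncomputable section

open scoped BigOperators Matrix Matrix.Norms.Operator
open NormedSpace

namespace Literature.MathematicalPhysics.QuantumFieldTheory.BalabanImbrieJaffe1984to88.BIJ88TraceLog574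

open Literature.MathematicalPhysics.QuantumFieldTheory.Dimock2011to13.LocalSquareRootDeterminant
  (R5real hasSum_R5real det_loc_eq_det_mul_rexp cplx norm_trace_logOnePlus_neg_le)
open Literature.MathematicalPhysics.QuantumFieldTheory.BalabanImbrieJaffe1984to88.BIJ88Normalization46 (Z49 Z49_eq)

variable {n : Type*} [Fintype n] [DecidableEq n]

/-! ## Cyclicity under the trace: from `C^{1/2}WC^{1/2}` in (5.7.3) to `CW` in (5.7.4) -/

/-- `tr((AB)^l) = tr((BA)^l)` for `l ≥ 1` (from `(AB)^l A = A(BA)^l` and `tr(MA) = tr(AM)`). [folklore] -/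
private theorem trace_pow_succ_mul_comm {R : Type*} [CommRing R] (A B : Matrix n n R) (k : ℕ) :
    ((A * B) ^ (k + 1)).trace = ((B * A) ^ (k + 1)).trace := by
  rw [pow_succ, ← mul_assoc, mul_pow_mul, mul_assoc, Matrix.trace_mul_comm, mul_assoc, ← pow_succ]

/-- The traces printed in (5.7.4): `tr((C^{1/2}WC^{1/2})^l) = tr((CW)^l)` for `l ≥ 1`, `C = C^{1/2}C^{1/2}`.
[cite: BalabanImbrieJaffe1988, (5.7.3)–(5.7.4) p.289] -/
theorem trace_pow_sandwich {R : Type*} [CommRing R] (S W : Matrix n n R) (k : ℕ) :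
    ((S * W * S) ^ (k + 1)).trace = ((S * S * W) ^ (k + 1)).trace := by
  conv_lhs => rw [mul_assoc, trace_pow_succ_mul_comm, mul_assoc, trace_pow_succ_mul_comm]

/-! ## `det(I − X) = exp tr log(I − X)` for a small real matrix `X` -/

/-- `det(I − X) = e^{tr log(I − X)}` for a real matrix with `‖X‖ < 1` (`ℓ^∞`-operator norm), `tr log(I − X) =
−Σ_{l≥1}(1/l) tr X^l ∈ ℝ` being the tree's `R5real X` (its `det_loc_eq_det_mul_rexp` at `S = I`) — the identity behind
*"the determinant can be expanded as"* (5.7.4). [cite: BalabanImbrieJaffe1988, (5.7.3)–(5.7.4) p.289] -/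
theorem det_one_sub_eq_exp {X : Matrix n n ℝ} (hX : ‖X‖ < 1) : (1 - X).det = Real.exp (R5real X) := by
  have h := det_loc_eq_det_mul_rexp (S := (1 : Matrix n n ℝ)) (δ := X) (by simp) (by simpa using hX)
  simpa using h

/-- … in particular `det(I − X) > 0` (so the power `−½` in (5.7.3) is of a positive number).
[cite: BalabanImbrieJaffe1988, (5.7.3) p.289] -/
theorem det_one_sub_pos {X : Matrix n n ℝ} (hX : ‖X‖ < 1) : 0 < (1 - X).det := by
  rw [det_one_sub_eq_exp hX]
  exact Real.exp_pos _

/-- The series of (5.7.4) for the operator `X` itself: `Σ_{l≥1} (1/2l) tr X^l` converges to `−½ tr log(I − X)` for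
`‖X‖ < 1` (the tree's `hasSum_R5real`, halved and re-indexed from `l = 1`). [cite: BalabanImbrieJaffe1988, (5.7.4) p.289] -/
theorem hasSum_half_trace_pow {X : Matrix n n ℝ} (hX : ‖X‖ < 1) :
    HasSum (fun l : ℕ => 1 / (2 * ((l : ℝ) + 1)) * (X ^ (l + 1)).trace) (-(1 / 2) * R5real X) := by
  have h := (hasSum_R5real hX).mul_left (-(1 / 2 : ℝ))
  have h1 := (hasSum_nat_add_iff' 1).mpr h
  have h0 : (∑ i ∈ Finset.range 1, -(1 / 2 : ℝ) * (-((1 : ℝ) / (i : ℕ)) * (X ^ i).trace)) = 0 := by simp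
  rw [h0, sub_zero] at h1
  refine h1.congr_fun fun l => ?_
  have hl : (l : ℝ) + 1 ≠ 0 := by positivity
  push_cast
  field_simp

/-! ## (5.7.4) -/

/-- **(5.7.4), the series**: for `‖C^{1/2}WC^{1/2}‖ < 1` the printed series converges,
`Σ_{l=1}^{∞} (1/2l) tr((CW)^l) = −½ tr log(I − C^{1/2}WC^{1/2})` (`S = C^{1/2}`, `C = S²`).
[cite: BalabanImbrieJaffe1988, (5.7.4) p.289] -/
theorem hasSum_eq574 {S W : Matrix n n ℝ} (hW : ‖S * W * S‖ < 1) :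
    HasSum (fun l : ℕ => 1 / (2 * ((l : ℝ) + 1)) * ((S * S * W) ^ (l + 1)).trace) (-(1 / 2) * R5real (S * W * S)) := by
  refine (hasSum_half_trace_pow hW).congr_fun fun l => ?_
  rw [trace_pow_sandwich]

/-- **(5.7.4)** p. 289 [PDF 33], verbatim: *"Thus the operator after the identity is bounded by a very small number. Thus the
determinant can be expanded as exp[Σ_{l=1}^{∞} (1/2l) tr(C^{(j)}_{Λ₁₀^{(j)}}(u_{k+1})W^{(j)})^l]. (5.7.4)"* — PROVED for finite
real matrices: `[det(I − C^{1/2}WC^{1/2})]^{−1/2} = exp[Σ_{l≥1}(1/2l) tr((CW)^l)]` whenever `‖C^{1/2}WC^{1/2}‖ < 1`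
(`S = C^{1/2}`, `C = S²`; `ℓ^∞`-operator norm). [cite: BalabanImbrieJaffe1988, (5.7.4) p.289] -/
theorem det_rpow_eq574 {S W : Matrix n n ℝ} (hW : ‖S * W * S‖ < 1) :
    ((1 - S * W * S).det) ^ (-(1 / 2 : ℝ)) =
      Real.exp (∑' l : ℕ, 1 / (2 * ((l : ℝ) + 1)) * ((S * S * W) ^ (l + 1)).trace) := by
  rw [det_one_sub_eq_exp hW, ← Real.exp_mul, (hasSum_eq574 hW).tsum_eq, mul_comm]

/-- (5.7.4) in logarithmic form: `−½ log det(I − C^{1/2}WC^{1/2}) = Σ_{l≥1}(1/2l) tr((CW)^l)`.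
[cite: BalabanImbrieJaffe1988, (5.7.4) p.289] -/
theorem log_det_eq574 {S W : Matrix n n ℝ} (hW : ‖S * W * S‖ < 1) :
    -(1 / 2) * Real.log (1 - S * W * S).det = ∑' l : ℕ, 1 / (2 * ((l : ℝ) + 1)) * ((S * S * W) ^ (l + 1)).trace := by
  rw [det_one_sub_eq_exp hW, Real.log_exp, (hasSum_eq574 hW).tsum_eq]

/-! ## The size of the exponent -/

/-- The `ℓ^∞`-operator norm is unchanged by complexification. [folklore] -/
private theorem norm_cplx_eq (M : Matrix n n ℝ) : ‖cplx M‖ = ‖M‖ := by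
  simp only [Matrix.linfty_opNorm_def, Matrix.map_apply]
  congr 1
  refine Finset.sup_congr rfl fun i _ => Finset.sum_congr rfl fun j _ => ?_
  ext; simp

/-- `|tr log(I − X)| ≤ #n · (−log(1 − ‖X‖))` for a real `X` with `‖X‖ < 1`. [folklore] -/
private theorem abs_R5real_le {X : Matrix n n ℝ} (hX : ‖X‖ < 1) : |R5real X| ≤ Fintype.card n * (-Real.log (1 - ‖X‖)) := by
  have hXc : ‖cplx X‖ < 1 := by rwa [norm_cplx_eq]
  have h := norm_trace_logOnePlus_neg_le hXc
  rw [norm_cplx_eq] at h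
  exact (Complex.abs_re_le_norm _).trans h

/-- `−log(1 − t) ≤ 2t` for `0 ≤ t ≤ ½`. [folklore] -/
private theorem neg_log_one_sub_le_two_mul {t : ℝ} (h0 : 0 ≤ t) (h1 : t ≤ 1 / 2) : -Real.log (1 - t) ≤ 2 * t := by
  have ht : 0 < 1 - t := by linarith
  have h := Real.one_sub_inv_le_log_of_pos ht
  have hid : (1 - t)⁻¹ - 1 = t / (1 - t) := by
    field_simp
    ring
  have key : -Real.log (1 - t) ≤ t / (1 - t) := by linarith
  calc -Real.log (1 - t) ≤ t / (1 - t) := key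
    _ ≤ t / (1 / 2) := div_le_div_of_nonneg_left h0 (by norm_num) (by linarith)
    _ = 2 * t := by ring

/-- The exponent of (5.7.4) is controlled by the smallness of *"the operator after the identity"*:
`|Σ_{l≥1}(1/2l) tr((CW)^l)| ≤ (#n/2)·(−log(1 − ‖C^{1/2}WC^{1/2}‖))`. [cite: BalabanImbrieJaffe1988, (5.7.4) p.289] -/
theorem abs_tsum574_le {S W : Matrix n n ℝ} (hW : ‖S * W * S‖ < 1) :
    |∑' l : ℕ, 1 / (2 * ((l : ℝ) + 1)) * ((S * S * W) ^ (l + 1)).trace| ≤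
      Fintype.card n / 2 * (-Real.log (1 - ‖S * W * S‖)) := by
  rw [(hasSum_eq574 hW).tsum_eq, abs_mul, abs_neg, abs_of_pos (by norm_num : (0 : ℝ) < 1 / 2)]
  have h := abs_R5real_le hW
  have hlog : 0 ≤ -Real.log (1 - ‖S * W * S‖) := by
    rw [neg_nonneg]
    exact Real.log_nonpos (by linarith [norm_nonneg (S * W * S)]) (by linarith [norm_nonneg (S * W * S)])
  nlinarith

/-- … hence `|Σ_{l≥1}(1/2l) tr((CW)^l)| ≤ #n·‖C^{1/2}WC^{1/2}‖` when `‖C^{1/2}WC^{1/2}‖ ≤ ½` (linear in the volume and in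
the small operator). [cite: BalabanImbrieJaffe1988, (5.7.4) p.289] -/
theorem abs_tsum574_le_card_mul {S W : Matrix n n ℝ} (hW : ‖S * W * S‖ ≤ 1 / 2) :
    |∑' l : ℕ, 1 / (2 * ((l : ℝ) + 1)) * ((S * S * W) ^ (l + 1)).trace| ≤ Fintype.card n * ‖S * W * S‖ := by
  have hW1 : ‖S * W * S‖ < 1 := hW.trans_lt (by norm_num)
  calc |∑' l : ℕ, 1 / (2 * ((l : ℝ) + 1)) * ((S * S * W) ^ (l + 1)).trace|
        ≤ Fintype.card n / 2 * (-Real.log (1 - ‖S * W * S‖)) := abs_tsum574_le hW1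
    _ ≤ Fintype.card n / 2 * (2 * ‖S * W * S‖) :=
        mul_le_mul_of_nonneg_left (neg_log_one_sub_le_two_mul (norm_nonneg _) hW) (by positivity)
    _ = Fintype.card n * ‖S * W * S‖ := by ring

/-! ## (5.7.3) and (5.7.4) for the normalization factors (4.9) -/

/-- **(5.7.3)** p. 289 [PDF 33], verbatim: *"and so Z^{(j)}_{Λ₁₀^{(j)}}(u_k) = Z^{(j)}_{Λ₁₀^{(j)}}(u_{k+1})[det(I −
C^{(j)}(u_{k+1})^{1/2}W^{(j)}C^{(j)}(u_{k+1})^{1/2})]^{−1/2}. (5.7.3)"* — PROVED for the typed normalization factor (4.9)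
(`BIJ88Normalization46.Z49 T E N = e^{−E N}∫dφ exp(−½⟨φ, Tφ⟩)`): the quadratic forms being `T(u_k) = C^{−1} − W` (by (5.7.2))
and `T(u_{k+1}) = C^{−1}`, both positive definite, with `C^{−1} = (C^{−1/2})²` and `C^{1/2}C^{−1/2} = C^{−1/2}C^{1/2} = I`
(the determinant algebra is r16's `BIJ88Sect5StatementsPart4.det_eq573`). [cite: BalabanImbrieJaffe1988, (5.7.3) p.289] -/
theorem Z49_eq573 {Cinv S Sinv W : Matrix n n ℝ} (h1 : S * Sinv = 1) (h2 : Sinv * S = 1) (hC : Sinv * Sinv = Cinv)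
    (hCinv : Cinv.PosDef) (hT : (Cinv - W).PosDef) (E N : ℝ) :
    Z49 (Cinv - W) E N = Z49 Cinv E N * ((1 - S * W * S).det) ^ (-(1 / 2 : ℝ)) := by
  have hdet := BIJ88Sect5StatementsPart4.det_eq573 (W := W) h1 h2 hC
  have hpos1 : 0 < Cinv.det := hCinv.det_pos
  have hpos3 : 0 < (1 - S * W * S).det := by
    have h := hT.det_pos
    rw [hdet] at h
    exact (mul_pos_iff_of_pos_left hpos1).mp h
  rw [Z49_eq _ hT, Z49_eq _ hCinv, hdet, Real.sqrt_mul hpos1.le, Real.rpow_neg hpos3.le, ← Real.sqrt_eq_rpow]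
  have hs1 : Real.sqrt Cinv.det ≠ 0 := (Real.sqrt_pos.2 hpos1).ne'
  have hs3 : Real.sqrt (1 - S * W * S).det ≠ 0 := (Real.sqrt_pos.2 hpos3).ne'
  field_simp

/-- **(5.7.3) with (5.7.4)**: under the smallness `‖C^{1/2}WC^{1/2}‖ < 1`,
`Z^{(j)}(u_k) = Z^{(j)}(u_{k+1}) · exp[Σ_{l=1}^{∞} (1/2l) tr((C^{(j)}(u_{k+1})W^{(j)})^l)]` for the typed normalization factors
(4.9) (`C = (C^{1/2})²`). [cite: BalabanImbrieJaffe1988, (5.7.3)–(5.7.4) p.289] -/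
theorem Z49_eq574 {C Cinv S Sinv W : Matrix n n ℝ} (h1 : S * Sinv = 1) (h2 : Sinv * S = 1) (hC : Sinv * Sinv = Cinv)
    (hSS : S * S = C) (hCinv : Cinv.PosDef) (hT : (Cinv - W).PosDef) (hW : ‖S * W * S‖ < 1) (E N : ℝ) :
    Z49 (Cinv - W) E N =
      Z49 Cinv E N * Real.exp (∑' l : ℕ, 1 / (2 * ((l : ℝ) + 1)) * ((C * W) ^ (l + 1)).trace) := by
  rw [Z49_eq573 h1 h2 hC hCinv hT, det_rpow_eq574 hW, hSS]

/-- The product over the steps `j = 0, …, k − 1` of (5.7.3)–(5.7.4) — the left-hand factorization in the summary **(5.7.13)**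
p. 295 (*"Π_{j=0}^{k−1} Z^{(j)}(u_{k+1}ũ̃) = Π_{j=0}^{k−1} Z^{(j)}(u_{k+1}) exp[…]"*): `Π_j Z_j(C_j^{−1} − W_j) = (Π_j Z_j(C_j^{−1})) ·
exp[Σ_j Σ_{l≥1}(1/2l) tr((C_jW_j)^l)]` (the resummation of the exponent into `−Q^{(k)} − Σ_X W₂^{(k)}(X)` that (5.7.13) asserts is
NOT claimed here). [cite: BalabanImbrieJaffe1988, (5.7.3)–(5.7.4) p.289, (5.7.13) p.295] -/
theorem prod_Z49_eq574 {J : Type*} (s : Finset J) {C Cinv S Sinv W : J → Matrix n n ℝ} {E N : J → ℝ}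
    (h1 : ∀ j ∈ s, S j * Sinv j = 1) (h2 : ∀ j ∈ s, Sinv j * S j = 1) (hC : ∀ j ∈ s, Sinv j * Sinv j = Cinv j)
    (hSS : ∀ j ∈ s, S j * S j = C j) (hCinv : ∀ j ∈ s, (Cinv j).PosDef) (hT : ∀ j ∈ s, (Cinv j - W j).PosDef)
    (hW : ∀ j ∈ s, ‖S j * W j * S j‖ < 1) :
    ∏ j ∈ s, Z49 (Cinv j - W j) (E j) (N j) =
      (∏ j ∈ s, Z49 (Cinv j) (E j) (N j)) *
        Real.exp (∑ j ∈ s, ∑' l : ℕ, 1 / (2 * ((l : ℝ) + 1)) * ((C j * W j) ^ (l + 1)).trace) := by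
  rw [Real.exp_sum, ← Finset.prod_mul_distrib]
  exact Finset.prod_congr rfl fun j hj => Z49_eq574 (h1 j hj) (h2 j hj) (hC j hj) (hSS j hj) (hCinv j hj) (hT j hj) (hW j hj) _ _

/-! ## Non-vacuity -/

/-- The hypotheses of (5.7.4) are met: on a two-point index set, `S = I`, `W = ¼·I` (`‖SWS‖ = ¼ < 1`), and then
`det(I − SWS)^{−1/2} = exp[Σ_{l≥1}(1/2l) tr((S²W)^l)]`. -/
example : ((1 - (1 : Matrix (Fin 2) (Fin 2) ℝ) * ((1 / 4 : ℝ) • (1 : Matrix (Fin 2) (Fin 2) ℝ)) * 1).det) ^ (-(1 / 2 : ℝ)) =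
    Real.exp (∑' l : ℕ, 1 / (2 * ((l : ℝ) + 1)) *
      (((1 : Matrix (Fin 2) (Fin 2) ℝ) * 1 * ((1 / 4 : ℝ) • (1 : Matrix (Fin 2) (Fin 2) ℝ))) ^ (l + 1)).trace) := by
  refine det_rpow_eq574 ?_
  rw [Matrix.one_mul, Matrix.mul_one, norm_smul, norm_one]
  norm_num

end Literature.MathematicalPhysics.QuantumFieldTheory.BalabanImbrieJaffe1984to88.BIJ88TraceLog574

end
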